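import Literature.Probability.LatticeModels.LoopO1
import Literature.Probability.LatticeModels.GKSInequalities
import Literature.Probability.LatticeModels.ThermodynamicLimit
import HarnessLib

/-!
# Tetrahedral coordinate-permutation symmetry of `(Λ_N, l·tetra)` (stub `stub_symmetry`)

Support file for the line `Sketch` of the crux `StrandShadow` (stmt-CriticalPhenomena-14626).

On the box `Λ_N = {−N..N}³ ⊂ ℤ³` with its nearest-neighbour graph
`G_N = (zdGraph 3).comap Subtype.val`, the coordinate transpositions `y ↔ z` and `x ↔ z`
(`Site.signedPerm (Equiv.swap 1 2) 1`, `Site.signedPerm (Equiv.swap 0 2) 1`) are graph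
automorphisms preserving the box (`zdSignedPermIso`, `signedPerm_mem_box_iff`).  For the sources
`a i = l · tetra i`, `tetra = [(-1,-1,-1), (1,1,-1), (1,-1,1), (-1,1,1)]`, the first fixes `a 0`,
`a 3` and swaps `a 1 ↔ a 2`, the second fixes `a 0`, `a 2` and swaps `a 1 ↔ a 3`.  Consequently

* the free finite-volume pair correlations agree: `G₀₂ = G₀₁ = G₀₃`, `G₁₃ = G₂₃ = G₁₂`
  (`isingCorr_map_equiv`, Friedli–Velenik Exercise 3.14 in finite volume);
* the "clean" four-source `T`-join sums of the three pairings agree: pushing an edge set forward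
  along an automorphism `ψ` (`F ↦ F.map (Sym2.map ψ)`) preserves `E(G_N)`, cardinalities, degree
  parities (hence `tJoins G_N univ {a i}` when `ψ` permutes the sources) and connectivity
  (`SimpleGraph.Iso.reachable_iff`).

## Contents

* `map_sym2Map_symm_map`, `mk_map_mem_map_iff`, `card_filter_mem_map`, `reachable_map_iff`,
  `map_mem_tJoins`, `sum_filter_tJoins_eq_of_equiv` — transport of edge sets / `T`-joins /
  filtered `T`-join sums along a graph automorphism of a finite graph;
* `exists_boxEquiv` — coordinate permutations as automorphisms of the box graph;
* `mem_image_iff_of_perm` — a bijection permuting a family preserves its image;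
* `stub_symmetry` — the registered stub.
-/

noncomputable section

open Finset SimpleGraph
open Literature.Probability.LatticeModels
open Literature.Probability.Percolation (zdSignedPermIso signedPerm_mem_box_iff)

namespace Summit.CriticalPhenomena.Ising3DConformalLimit.Theorems.StrandShadowSketch

open scoped Classical

section Transport

variable {V : Type*} [Fintype V] [DecidableEq V] (G : SimpleGraph V) [DecidableRel G.Adj]

omit [Fintype V] [DecidableEq V] in
/-- Pushing an edge set forward along `ψ` and then along `ψ⁻¹` is the identity. -/
theorem map_sym2Map_symm_map (ψ : V ≃ V) (F : Finset (Sym2 V)) :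
    (F.map (Function.Embedding.sym2Map ψ.toEmbedding)).map
        (Function.Embedding.sym2Map ψ.symm.toEmbedding) = F := by
  rw [Finset.map_map]
  conv_rhs => rw [← Finset.map_refl (s := F)]
  congr 1
  ext e
  simp [Sym2.map_map]

omit [Fintype V] [DecidableEq V] in
/-- Membership of a pushed-forward edge in a pushed-forward edge set. -/
theorem mk_map_mem_map_iff (ψ : V ≃ V) (F : Finset (Sym2 V)) (x y : V) :
    s(ψ x, ψ y) ∈ F.map (Function.Embedding.sym2Map ψ.toEmbedding) ↔ s(x, y) ∈ F := by
  have h := Finset.mem_map' (Function.Embedding.sym2Map ψ.toEmbedding) (a := s(x, y)) (s := F)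
  rwa [Function.Embedding.sym2Map_apply, Equiv.coe_toEmbedding, Sym2.map_mk] at h

omit [Fintype V] in
/-- Degrees are transported: the `ψ v`-degree of `ψ(F)` is the `v`-degree of `F`. -/
theorem card_filter_mem_map (ψ : V ≃ V) (F : Finset (Sym2 V)) (v : V) :
    #((F.map (Function.Embedding.sym2Map ψ.toEmbedding)).filter (ψ v ∈ ·)) =
      #(F.filter (v ∈ ·)) := by
  rw [Finset.filter_map, Finset.card_map]
  congr 1
  refine Finset.filter_congr fun e _ => ?_
  simp only [Function.comp_apply, Function.Embedding.sym2Map_apply, Equiv.coe_toEmbedding,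
    Sym2.mem_map]
  constructor
  · rintro ⟨w, hw, hwv⟩
    rwa [← ψ.injective hwv]
  · intro h
    exact ⟨v, h, rfl⟩

omit [Fintype V] [DecidableEq V] in
/-- Connectivity is transported: `ψ x` and `ψ y` are joined in `ψ(F)` iff `x` and `y` are joined
in `F` (the vertex bijection `ψ` is a graph isomorphism `(V, F) ≃g (V, ψ(F))`). -/
theorem reachable_map_iff (ψ : V ≃ V) (F : Finset (Sym2 V)) (x y : V) :
    (fromEdgeSet (↑(F.map (Function.Embedding.sym2Map ψ.toEmbedding)) : Set (Sym2 V))).Reachable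
        (ψ x) (ψ y) ↔ (fromEdgeSet (↑F : Set (Sym2 V))).Reachable x y := by
  let φ : fromEdgeSet (↑F : Set (Sym2 V)) ≃g
      fromEdgeSet (↑(F.map (Function.Embedding.sym2Map ψ.toEmbedding)) : Set (Sym2 V)) :=
    { toEquiv := ψ
      map_rel_iff' := fun {a b} => by
        simp only [fromEdgeSet_adj, Finset.mem_coe, mk_map_mem_map_iff, ne_eq,
          EmbeddingLike.apply_eq_iff_eq] }
  exact φ.reachable_iff

/-- A graph automorphism preserving the source set maps `T`-joins to `T`-joins. -/
theorem map_mem_tJoins (ψ : V ≃ V) (hadj : ∀ x y, G.Adj (ψ x) (ψ y) ↔ G.Adj x y)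
    {A : Finset V} (hA : ∀ v, ψ v ∈ A ↔ v ∈ A) {F : Finset (Sym2 V)}
    (hF : F ∈ tJoins G Set.univ A) :
    F.map (Function.Embedding.sym2Map ψ.toEmbedding) ∈ tJoins G Set.univ A := by
  rw [mem_tJoins] at hF ⊢
  obtain ⟨hE, -, hdeg⟩ := hF
  refine ⟨?_, Set.subset_univ _, ?_⟩
  · intro e he
    rw [Finset.mem_map] at he
    obtain ⟨e, he', rfl⟩ := he
    have := hE he'
    rw [mem_edgeFinset] at this ⊢
    induction e using Sym2.ind with
    | h x y =>
      rw [mem_edgeSet] at this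
      simpa [Sym2.map_mk, hadj] using this
  · intro v
    obtain ⟨w, rfl⟩ := ψ.surjective v
    rw [card_filter_mem_map, hA]
    exact hdeg w

/-- **Transport of filtered `T`-join sums** along a graph automorphism `ψ` preserving the source
set `A`: if the predicate `Q` on pushed-forward edge sets corresponds to `P`, then
`Σ_{F ∈ 𝒯_A, P F} t^{|F|} = Σ_{F ∈ 𝒯_A, Q F} t^{|F|}` (the bijection `F ↦ ψ(F)` of `𝒯_A`). -/
theorem sum_filter_tJoins_eq_of_equiv (ψ : V ≃ V) (hadj : ∀ x y, G.Adj (ψ x) (ψ y) ↔ G.Adj x y)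
    {A : Finset V} (hA : ∀ v, ψ v ∈ A ↔ v ∈ A) (P Q : Finset (Sym2 V) → Prop)
    [DecidablePred P] [DecidablePred Q]
    (hPQ : ∀ F, Q (F.map (Function.Embedding.sym2Map ψ.toEmbedding)) ↔ P F) (t : ℝ) :
    ∑ F ∈ (tJoins G Set.univ A).filter P, t ^ F.card =
      ∑ F ∈ (tJoins G Set.univ A).filter Q, t ^ F.card := by
  have hadj' : ∀ x y, G.Adj (ψ.symm x) (ψ.symm y) ↔ G.Adj x y := fun x y => by
    simpa using (hadj (ψ.symm x) (ψ.symm y)).symm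
  have hA' : ∀ v, ψ.symm v ∈ A ↔ v ∈ A := fun v => by simpa using (hA (ψ.symm v)).symm
  have hback : ∀ F : Finset (Sym2 V), (F.map (Function.Embedding.sym2Map ψ.symm.toEmbedding)).map
      (Function.Embedding.sym2Map ψ.toEmbedding) = F := fun F => by
    simpa using map_sym2Map_symm_map ψ.symm F
  refine Finset.sum_nbij' (fun F => F.map (Function.Embedding.sym2Map ψ.toEmbedding))
    (fun F => F.map (Function.Embedding.sym2Map ψ.symm.toEmbedding)) ?_ ?_ ?_ ?_ ?_
  · intro F hF
    rw [Finset.mem_filter] at hF ⊢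
    exact ⟨map_mem_tJoins G ψ hadj hA hF.1, (hPQ F).2 hF.2⟩
  · intro F hF
    rw [Finset.mem_filter] at hF ⊢
    refine ⟨map_mem_tJoins G ψ.symm hadj' hA' hF.1, ?_⟩
    have := hPQ (F.map (Function.Embedding.sym2Map ψ.symm.toEmbedding))
    rw [hback] at this
    exact this.1 hF.2
  · intro F _
    exact map_sym2Map_symm_map ψ F
  · intro F _
    exact hback F
  · intro F _
    rw [Finset.card_map]

end Transport

/-! ### The box `Λ_N ⊂ ℤ³` and its coordinate permutations -/

/-- Coordinate permutations of `ℤ³` restrict to automorphisms of the box graph on `Λ_N`. -/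
theorem exists_boxEquiv (N : ℕ) (π : Equiv.Perm (Fin 3)) :
    ∃ ψ : ↥(box 3 N) ≃ ↥(box 3 N),
      (∀ x, ((ψ x : ↥(box 3 N)) : Site 3) = Site.signedPerm π 1 (x : Site 3)) ∧
      ∀ x y, ((zdGraph 3).comap (Subtype.val : ↥(box 3 N) → Site 3)).Adj (ψ x) (ψ y) ↔
        ((zdGraph 3).comap (Subtype.val : ↥(box 3 N) → Site 3)).Adj x y := by
  refine ⟨(Site.signedPerm π 1).subtypeEquiv fun x => (signedPerm_mem_box_iff π 1).symm,
    fun x => rfl, fun x y => ?_⟩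
  simp only [SimpleGraph.comap_adj, Equiv.subtypeEquiv_apply]
  exact (zdSignedPermIso π 1).map_rel_iff'

/-- A bijection permuting a `Fin 4`-indexed family preserves (membership in) its image. -/
theorem mem_image_iff_of_perm {V : Type*} [DecidableEq V] (ψ : V ≃ V) (a : Fin 4 → V)
    (σ : Equiv.Perm (Fin 4)) (h : ∀ i, ψ (a i) = a (σ i)) (v : V) :
    ψ v ∈ Finset.univ.image a ↔ v ∈ Finset.univ.image a := by
  simp only [Finset.mem_image, Finset.mem_univ, true_and]
  constructor
  · rintro ⟨i, hi⟩
    refine ⟨σ.symm i, ψ.injective ?_⟩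
    rw [h, Equiv.apply_symm_apply, hi]
  · rintro ⟨i, rfl⟩
    exact ⟨σ i, (h i).symm⟩

/-- **stub_symmetry** — tetrahedral coordinate-permutation symmetry of `(Λ_N, l·tetra)`: the
transpositions `y ↔ z` and `x ↔ z` of `{−N..N}³` are automorphisms of the box graph fixing
`a₀` and swapping `a₁ ↔ a₂`, resp. `a₁ ↔ a₃`; consequently (any `β`, any `t`) the pair
correlations `G₀₂ = G₀₁ = G₀₃`, `G₁₃ = G₂₃ = G₁₂` and the clean four-source counts of the three
pairings coincide. -/
theorem stub_symmetry :
    ∀ (l N : ℕ) (a : Fin 4 → ↥(box 3 N)),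
      (∀ i, ((a i : Site 3)) = (l : ℤ) •
        (![![-1, -1, -1], ![1, 1, -1], ![1, -1, 1], ![-1, 1, 1]] : Fin 4 → Site 3) i) →
      ∀ (β t : ℝ),
      (let G := ((zdGraph 3).comap (Subtype.val : ↥(box 3 N) → Site 3))
       let Gc : Fin 4 → Fin 4 → ℝ := fun i j => isingCorr G Finset.univ β 0 .free {a i, a j}
       let C : Fin 4 → Fin 4 → ℝ := fun j k =>
         ∑ F ∈ (tJoins G Set.univ (Finset.univ.image a)).filter (fun F : Finset (Sym2 ↥(box 3 N)) =>
            ¬ (SimpleGraph.fromEdgeSet (↑F : Set (Sym2 ↥(box 3 N)))).Reachable (a 0) (a j) ∧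
            ¬ (SimpleGraph.fromEdgeSet (↑F : Set (Sym2 ↥(box 3 N)))).Reachable (a 0) (a k)),
           t ^ F.card
       Gc 0 2 = Gc 0 1 ∧ Gc 0 3 = Gc 0 1 ∧ Gc 1 3 = Gc 2 3 ∧ Gc 1 2 = Gc 2 3 ∧
         C 1 3 = C 2 3 ∧ C 1 2 = C 2 3) := by
  intro l N a ha β t
  dsimp only
  obtain ⟨ψ₁, hψ₁, hadj₁⟩ := exists_boxEquiv N (Equiv.swap (1 : Fin 3) 2)
  obtain ⟨ψ₂, hψ₂, hadj₂⟩ := exists_boxEquiv N (Equiv.swap (0 : Fin 3) 2)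
  have h₁ : ∀ i, ψ₁ (a i) = a (Equiv.swap (1 : Fin 4) 2 i) := by
    intro i
    apply Subtype.ext
    rw [hψ₁, ha, ha]
    ext k
    fin_cases i <;> fin_cases k <;> simp [Equiv.swap_apply_of_ne_of_ne]
  have h₂ : ∀ i, ψ₂ (a i) = a (Equiv.swap (1 : Fin 4) 3 i) := by
    intro i
    apply Subtype.ext
    rw [hψ₂, ha, ha]
    ext k
    fin_cases i <;> fin_cases k <;> simp [Equiv.swap_apply_of_ne_of_ne]
  have hA₁ := mem_image_iff_of_perm ψ₁ a _ h₁
  have hA₂ := mem_image_iff_of_perm ψ₂ a _ h₂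
  have e₁ : ψ₁ (a 0) = a 0 ∧ ψ₁ (a 1) = a 2 ∧ ψ₁ (a 2) = a 1 ∧ ψ₁ (a 3) = a 3 :=
    ⟨(h₁ 0).trans (congrArg a (by decide)), (h₁ 1).trans (congrArg a (by decide)),
      (h₁ 2).trans (congrArg a (by decide)), (h₁ 3).trans (congrArg a (by decide))⟩
  have e₂ : ψ₂ (a 0) = a 0 ∧ ψ₂ (a 1) = a 3 ∧ ψ₂ (a 2) = a 2 ∧ ψ₂ (a 3) = a 1 :=
    ⟨(h₂ 0).trans (congrArg a (by decide)), (h₂ 1).trans (congrArg a (by decide)),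
      (h₂ 2).trans (congrArg a (by decide)), (h₂ 3).trans (congrArg a (by decide))⟩
  have hcorr₁ := fun A : Finset ↥(box 3 N) =>
    isingCorr_map_equiv ((zdGraph 3).comap (Subtype.val : ↥(box 3 N) → Site 3)) ψ₁ hadj₁
      (Λ := Finset.univ) (fun x => by simp) β 0 .free (fun _ => rfl) A
  have hcorr₂ := fun A : Finset ↥(box 3 N) =>
    isingCorr_map_equiv ((zdGraph 3).comap (Subtype.val : ↥(box 3 N) → Site 3)) ψ₂ hadj₂
      (Λ := Finset.univ) (fun x => by simp) β 0 .free (fun _ => rfl) A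
  refine ⟨?_, ?_, ?_, ?_, ?_, ?_⟩
  · have := hcorr₁ {a 0, a 1}
    rw [Finset.map_insert, Finset.map_singleton, Equiv.coe_toEmbedding, e₁.1, e₁.2.1] at this
    exact this
  · have := hcorr₂ {a 0, a 1}
    rw [Finset.map_insert, Finset.map_singleton, Equiv.coe_toEmbedding, e₂.1, e₂.2.1] at this
    exact this
  · have := hcorr₁ {a 2, a 3}
    rw [Finset.map_insert, Finset.map_singleton, Equiv.coe_toEmbedding, e₁.2.2.1, e₁.2.2.2] at this
    exact this
  · have := hcorr₂ {a 2, a 3}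
    rw [Finset.map_insert, Finset.map_singleton, Equiv.coe_toEmbedding, e₂.2.2.1, e₂.2.2.2,
      Finset.pair_comm (a 2) (a 1)] at this
    exact this
  · refine sum_filter_tJoins_eq_of_equiv _ ψ₁ hadj₁ hA₁ _ _ (fun F => ?_) t
    rw [← reachable_map_iff ψ₁ F (a 0) (a 1), ← reachable_map_iff ψ₁ F (a 0) (a 3), e₁.1,
      e₁.2.1, e₁.2.2.2]
  · refine sum_filter_tJoins_eq_of_equiv _ ψ₂ hadj₂ hA₂ _ _ (fun F => ?_) t
    rw [← reachable_map_iff ψ₂ F (a 0) (a 1), ← reachable_map_iff ψ₂ F (a 0) (a 2), e₂.1,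
      e₂.2.1, e₂.2.2.1]
    exact and_comm

end Summit.CriticalPhenomena.Ising3DConformalLimit.Theorems.StrandShadowSketch

end
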